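import Literature.MathematicalPhysics.QuantumManyBody.JelliumWeightedPythagoras
import Literature.MathematicalPhysics.QuantumManyBody.JelliumSliceContinuity
import HarnessLib

/-!
# Lieb–Solovej Lemma 5.3 (control of the terms with `ŵ_{p0,q0}`) in first quantization

Topic `Literature/MathematicalPhysics/QuantumManyBody` (the charged Bose gas, `JelliumBoseGas.foldyLaw`).
[LiebSolovej2001, Lemma 5.3]: the terms of `H^n_{ℓ,r,R}` containing `ŵ_{p0,q0}` or `ŵ_{0p,0q}`,
`p, q ≠ 0`, equal `(n̂₀ - ρℓ³)∑_{p,q≠0} ŵ_{p0,q0}a*_pa_q` and are bounded below by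
`-4π[ρ - nℓ⁻³]₊ n̂₊ R² - 4π n̂₊² ℓ⁻³R²`, because `0 ≤ ∑ŵ_{p0,q0}a*_pa_q ≤ 4πℓ⁻³R² n̂₊`
(`sup_x∫w_{r,R}(x,y)dy ≤ 4πR²`) and `n̂₀ = n - n̂₊` commutes with it.

First quantization (projections `Pⱼ`, `Qⱼ` of `JelliumSliceProjections.lean`; `m(x) = ∫w(x,y)dy`,
any measurable weight `0 ≤ m ≤ M`): in expectation in an `n`-body function `Ψ`,
`ℓ³∑ŵ_{p0,q0}a*_pa_q ↔ A = ∑ᵢ∫m(xᵢ)|QᵢΨ|²`, the pair block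
`∑_{i≠j}⟨PⱼQᵢΨ, w_{ij}PⱼQᵢΨ⟩ = ℓ⁻³B`, `B = ∑_{i≠j}∫m(xᵢ)|PⱼQᵢΨ|²`, and the lemma's sum of terms is
`T = ℓ⁻³B - ρA`. We prove

* `sum_weight_identity` — **`(n-1)A = B + D`**, `D = ∑_{i≠j}∫m(xᵢ)|QⱼQᵢΨ|²` (weighted Pythagoras
  in each `j ≠ i`; this is `n̂₀ = n - n̂₊` inside the expectation);
* `ls_lemma53` — **Lemma 5.3**: `ℓ⁻³B - ρA ≥ -[ρ - nℓ⁻³]₊ M ⟨n̂₊⟩ - ℓ⁻³ M ⟨n̂₊²⟩` with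
  `⟨n̂₊⟩ = ∑ᵢ∫|QᵢΨ|²`, `⟨n̂₊²⟩ = ∑ᵢ∫|QᵢΨ|² + ∑_{i≠j}∫|QⱼQᵢΨ|²` (`QᵢQᵢ = Qᵢ`); with `M = 4πR²`
  this is the printed bound.

## References

* [LiebSolovej2001] E. H. Lieb, J. P. Solovej, Commun. Math. Phys. 217 (2001) 127–163, Lemma 5.3
  (arXiv:cond-mat/0007425, pp. 11–12).
-/

noncomputable section

open MeasureTheory Set Filter Real
open scoped ENNReal NNReal Topology

namespace Literature.MathematicalPhysics.QuantumManyBody.JelliumBoseGas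

open BoseGas
open Literature.Barriers.AtomisticToContinuum.BoseGas (measurable_lintegral_cell_update)

variable {n : ℕ} {ℓ : ℝ}

/-! ### Weighted Pythagoras with a bound only on the box -/

/-- Weighted Pythagoras (`lintegral_cellN_weight_normSq_eq_add`) with the fibre bound required only
for configurations in `cellN`. [cite: LiebSolovej2001, Lemma 5.3 (proof)] -/
theorem lintegral_cellN_weight_normSq_eq_add' (hℓ : 0 < ℓ) {i j : Fin n} (hij : i ≠ j)
    {m : Space → ℝ≥0∞} (hm : Measurable m) {F : Config n → ℂ} (hFm : Measurable F)
    (hPm : Measurable (sliceMean ℓ j F)) {C : ℝ}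
    (hC : ∀ X ∈ cellN n ℓ, ∀ y ∈ cell ℓ, ‖F (Function.update X j y)‖ ≤ C) :
    ∫⁻ X in cellN n ℓ, m (X i) * (‖F X‖₊ : ℝ≥0∞) ^ 2 =
      (∫⁻ X in cellN n ℓ, m (X i) * (‖sliceFluct ℓ j F X‖₊ : ℝ≥0∞) ^ 2) +
        ∫⁻ X in cellN n ℓ, m (X i) * (‖sliceMean ℓ j F X‖₊ : ℝ≥0∞) ^ 2 := by
  have hL3 : ENNReal.ofReal ℓ ^ 3 ≠ 0 := pow_ne_zero _ (by simpa using hℓ)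
  have hL3' : ENNReal.ofReal ℓ ^ 3 ≠ ⊤ := ENNReal.pow_ne_top ENNReal.ofReal_ne_top
  have hQm : Measurable (sliceFluct ℓ j F) := hFm.sub hPm
  have hmi : Measurable fun X : Config n => m (X i) := hm.comp (measurable_pi_apply i)
  have hH : Measurable fun X : Config n => m (X i) * (‖F X‖₊ : ℝ≥0∞) ^ 2 :=
    hmi.mul (hFm.nnnorm.coe_nnreal_ennreal.pow_const _)
  have hHQ : Measurable fun X : Config n => m (X i) * (‖sliceFluct ℓ j F X‖₊ : ℝ≥0∞) ^ 2 :=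
    hmi.mul (hQm.nnnorm.coe_nnreal_ennreal.pow_const _)
  have hHP : Measurable fun X : Config n => m (X i) * (‖sliceMean ℓ j F X‖₊ : ℝ≥0∞) ^ 2 :=
    hmi.mul (hPm.nnnorm.coe_nnreal_ennreal.pow_const _)
  have e1 := lintegral_cellN_lintegral_update j hH (L := ℓ)
  have e2 := lintegral_cellN_lintegral_update j hHQ (L := ℓ)
  have e3 := lintegral_cellN_lintegral_update j hHP (L := ℓ)
  have hupd : ∀ (X : Config n) (y : Space), (Function.update X j y) i = X i := fun X y =>
    Function.update_of_ne hij _ _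
  have hfib : ∀ X ∈ cellN n ℓ,
      ∫⁻ y in cell ℓ, m ((Function.update X j y) i) * (‖F (Function.update X j y)‖₊ : ℝ≥0∞) ^ 2 =
        (∫⁻ y in cell ℓ, m ((Function.update X j y) i) *
            (‖sliceFluct ℓ j F (Function.update X j y)‖₊ : ℝ≥0∞) ^ 2) +
          ∫⁻ y in cell ℓ, m ((Function.update X j y) i) *
            (‖sliceMean ℓ j F (Function.update X j y)‖₊ : ℝ≥0∞) ^ 2 := by
    intro X hX
    simp_rw [hupd, sliceMean_update]
    have hmF : Measurable fun y : Space => (‖F (Function.update X j y)‖₊ : ℝ≥0∞) ^ 2 :=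
      (hFm.comp (measurable_update _)).nnnorm.coe_nnreal_ennreal.pow_const _
    have hmQ : Measurable fun y : Space => (‖sliceFluct ℓ j F (Function.update X j y)‖₊ : ℝ≥0∞) ^ 2 :=
      (hQm.comp (measurable_update _)).nnnorm.coe_nnreal_ennreal.pow_const _
    rw [lintegral_const_mul _ hmF, lintegral_const_mul _ hmQ, setLIntegral_const, volume_cell,
      lintegral_cell_normSq_eq_of_bounded hℓ j hFm X (hC X hX), mul_add]
    ring
  have hmeasQ : Measurable fun X : Config n => ∫⁻ y in cell ℓ,
      m ((Function.update X j y) i) * (‖sliceFluct ℓ j F (Function.update X j y)‖₊ : ℝ≥0∞) ^ 2 :=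
    measurable_lintegral_cell_update ℓ j hHQ
  rw [← ENNReal.mul_right_inj hL3 hL3', mul_add, ← e1, ← e2, ← e3, ← lintegral_add_left hmeasQ]
  exact setLIntegral_congr_fun (measurableSet_cellN n ℓ) hfib

/-! ### `(n-1)A = B + D` -/

/-- **`(n - 1) A = B + D`** [LiebSolovej2001, Lemma 5.3 (proof: `n̂₀ = n - n̂₊` inside the
expectation)]: for continuous `Ψ`, a measurable weight `m`, and `ℓ > 0`,
`(n-1)∑ᵢ∫m(xᵢ)|QᵢΨ|² = ∑_{i≠j}∫m(xᵢ)|PⱼQᵢΨ|² + ∑_{i≠j}∫m(xᵢ)|QⱼQᵢΨ|²` on `Λ^n = cellN`.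
[cite: LiebSolovej2001, Lemma 5.3] -/
theorem sum_weight_identity (hℓ : 0 < ℓ) {Ψ : Config n → ℂ} (hΨ : Continuous Ψ)
    {m : Space → ℝ≥0∞} (hm : Measurable m) :
    ((n : ℝ≥0∞) - 1) * ∑ i : Fin n, ∫⁻ X in cellN n ℓ, m (X i) * (‖sliceFluct ℓ i Ψ X‖₊ : ℝ≥0∞) ^ 2 =
      (∑ i : Fin n, ∑ j ∈ Finset.univ.erase i,
          ∫⁻ X in cellN n ℓ, m (X i) * (‖sliceMean ℓ j (sliceFluct ℓ i Ψ) X‖₊ : ℝ≥0∞) ^ 2) +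
        ∑ i : Fin n, ∑ j ∈ Finset.univ.erase i,
          ∫⁻ X in cellN n ℓ, m (X i) * (‖sliceFluct ℓ j (sliceFluct ℓ i Ψ) X‖₊ : ℝ≥0∞) ^ 2 := by
  rw [← Finset.sum_add_distrib, Finset.mul_sum]
  refine Finset.sum_congr rfl fun i _ => ?_
  have hF : Continuous (sliceFluct ℓ i Ψ) := continuous_sliceFluct ℓ i hΨ
  -- a uniform bound on the fibres of `QᵢΨ` through configurations of the box
  rw [← Finset.sum_add_distrib]
  have hterm : ∀ j ∈ Finset.univ.erase i,
      (∫⁻ X in cellN n ℓ, m (X i) * (‖sliceMean ℓ j (sliceFluct ℓ i Ψ) X‖₊ : ℝ≥0∞) ^ 2) +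
        ∫⁻ X in cellN n ℓ, m (X i) * (‖sliceFluct ℓ j (sliceFluct ℓ i Ψ) X‖₊ : ℝ≥0∞) ^ 2 =
      ∫⁻ X in cellN n ℓ, m (X i) * (‖sliceFluct ℓ i Ψ X‖₊ : ℝ≥0∞) ^ 2 := by
    intro j hj
    have hij : i ≠ j := (Finset.ne_of_mem_erase hj).symm
    obtain ⟨C, hC⟩ := exists_bound_update_of_continuous hF ℓ j
    rw [add_comm, lintegral_cellN_weight_normSq_eq_add' hℓ hij hm hF.measurable
      (continuous_sliceMean ℓ j hF).measurable (C := C) fun X hX y hy =>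
        hC X (fun i' k => Set.Ico_subset_Icc_self (hX i' k)) y hy]
  rw [Finset.sum_congr rfl hterm, Finset.sum_const, Finset.card_erase_of_mem (Finset.mem_univ i),
    Finset.card_univ, Fintype.card_fin, nsmul_eq_mul]
  congr 1
  rw [ENNReal.natCast_sub, Nat.cast_one]

/-! ### Finiteness on the box -/

/-- The closed cube `([0,ℓ]³)ⁿ` of configuration space is compact and contains `cellN`. [folklore] -/
theorem isCompact_closedCubeN (n : ℕ) (ℓ : ℝ) :
    IsCompact {X : Config n | ∀ i k, X i k ∈ Set.Icc 0 ℓ} := by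
  have e : {X : Config n | ∀ i k, X i k ∈ Set.Icc 0 ℓ} =
      Set.univ.pi fun _ : Fin n => {x : Space | ∀ k, x k ∈ Set.Icc 0 ℓ} := by
    ext X; simp
  rw [e]
  exact isCompact_univ_pi fun _ => isCompact_closedCube ℓ

/-- `cellN ⊆ ([0,ℓ]³)ⁿ`. [folklore] -/
theorem cellN_subset_closedCubeN (n : ℕ) (ℓ : ℝ) :
    cellN n ℓ ⊆ {X : Config n | ∀ i k, X i k ∈ Set.Icc 0 ℓ} := fun _ hX i k =>
  Set.Ico_subset_Icc_self (hX i k)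

/-- A continuous function has `∫_{Λ^n} m(xᵢ)|G|² < ∞` for a bounded weight. [folklore] -/
theorem setLIntegral_cellN_weight_normSq_lt_top {G : Config n → ℂ} (hG : Continuous G) (ℓ : ℝ)
    {m : Space → ℝ≥0∞} {M : ℝ≥0∞} (hM : M ≠ ⊤) (hmle : ∀ x, m x ≤ M) (i : Fin n) :
    ∫⁻ X in cellN n ℓ, m (X i) * (‖G X‖₊ : ℝ≥0∞) ^ 2 < ⊤ := by
  obtain ⟨C, hC⟩ := (isCompact_closedCubeN n ℓ).exists_bound_of_continuousOn hG.continuousOn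
  have hpt : ∀ X ∈ cellN n ℓ, m (X i) * (‖G X‖₊ : ℝ≥0∞) ^ 2 ≤ M * ENNReal.ofReal (C ^ 2) := by
    intro X hX
    refine mul_le_mul' (hmle _) ?_
    rw [← ofReal_norm_sq_eq]
    exact ENNReal.ofReal_le_ofReal (pow_le_pow_left₀ (norm_nonneg _) (hC X (cellN_subset_closedCubeN n ℓ hX)) 2)
  refine lt_of_le_of_lt (setLIntegral_mono' (measurableSet_cellN n ℓ) hpt) ?_
  rw [setLIntegral_const, volume_cellN]
  exact ENNReal.mul_lt_top (ENNReal.mul_lt_top hM.lt_top ENNReal.ofReal_lt_top)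
    (ENNReal.pow_lt_top (ENNReal.pow_lt_top ENNReal.ofReal_lt_top))

/-- A continuous function has `∫_{Λ^n} |G|² < ∞`. [folklore] -/
theorem setLIntegral_cellN_normSq_lt_top {G : Config n → ℂ} (hG : Continuous G) (ℓ : ℝ) :
    ∫⁻ X in cellN n ℓ, (‖G X‖₊ : ℝ≥0∞) ^ 2 < ⊤ := by
  rcases Nat.eq_zero_or_pos n with hn | hn
  · subst hn
    obtain ⟨C, hC⟩ := (isCompact_closedCubeN 0 ℓ).exists_bound_of_continuousOn hG.continuousOn
    have hpt : ∀ X ∈ cellN 0 ℓ, (‖G X‖₊ : ℝ≥0∞) ^ 2 ≤ ENNReal.ofReal (C ^ 2) := by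
      intro X hX
      rw [← ofReal_norm_sq_eq]
      exact ENNReal.ofReal_le_ofReal (pow_le_pow_left₀ (norm_nonneg _) (hC X (cellN_subset_closedCubeN 0 ℓ hX)) 2)
    refine lt_of_le_of_lt (setLIntegral_mono' (measurableSet_cellN 0 ℓ) hpt) ?_
    rw [setLIntegral_const, volume_cellN]
    exact ENNReal.mul_lt_top ENNReal.ofReal_lt_top (ENNReal.pow_lt_top (ENNReal.pow_lt_top ENNReal.ofReal_lt_top))
  · have h := setLIntegral_cellN_weight_normSq_lt_top hG ℓ (m := fun _ => 1) ENNReal.one_ne_top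
      (fun _ => le_rfl) ⟨0, hn⟩
    simpa only [one_mul] using h

/-! ### Lemma 5.3 -/

/-- The arithmetic of Lemma 5.3: from `(n-1)a = b + d`, `0 ≤ a ≤ M·n₊`, `a + d ≤ M·n₊₊`:
`-[ρ - n/ℓ³]₊ M n₊ - ℓ⁻³ M n₊₊ ≤ ℓ⁻³ b - ρ a`. [cite: LiebSolovej2001, Lemma 5.3] -/
theorem lemma53_arith {nr ℓ3 ρ M a b d np npp : ℝ} (hℓ3 : 0 < ℓ3)
    (hid : (nr - 1) * a = b + d) (ha0 : 0 ≤ a) (ha : a ≤ M * np) (had : a + d ≤ M * npp) :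
    -(max (ρ - nr / ℓ3) 0 * M * np) - ℓ3⁻¹ * M * npp ≤ ℓ3⁻¹ * b - ρ * a := by
  have hb : b = (nr - 1) * a - d := by linarith
  subst hb
  have h1 : -(max (ρ - nr / ℓ3) 0) * a ≤ (nr / ℓ3 - ρ) * a :=
    mul_le_mul_of_nonneg_right (by linarith [le_max_left (ρ - nr / ℓ3) 0]) ha0
  have h2 : max (ρ - nr / ℓ3) 0 * a ≤ max (ρ - nr / ℓ3) 0 * (M * np) :=
    mul_le_mul_of_nonneg_left ha (le_max_right _ _)
  have h3 : ℓ3⁻¹ * (a + d) ≤ ℓ3⁻¹ * (M * npp) := mul_le_mul_of_nonneg_left had (inv_nonneg.2 hℓ3.le)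
  have e : ℓ3⁻¹ * ((nr - 1) * a - d) - ρ * a = (nr / ℓ3 - ρ) * a - ℓ3⁻¹ * (a + d) := by
    field_simp; ring
  rw [e]
  nlinarith

/-- **[LiebSolovej2001, Lemma 5.3] (control of the terms with `ŵ_{p0,q0}`), first-quantized
expectation form.** Let `Ψ` be a continuous `n`-body function, `ℓ > 0`, `ρ ∈ ℝ`, and
`m : ℝ³ → [0, M]` a measurable weight (`m(x) = ∫ w_{r,R}(x,y) dy ≤ 4πR² = M`). With
`A = ∑ᵢ∫_{Λ^n} m(xᵢ)|QᵢΨ|²` (`= ⟨Ψ, ℓ³∑_{p,q≠0}ŵ_{p0,q0}a*_pa_qΨ⟩`),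
`B = ∑_{i≠j}∫_{Λ^n} m(xᵢ)|PⱼQᵢΨ|²` (the pair block `∑_{i≠j}⟨PⱼQᵢΨ, w_{ij}PⱼQᵢΨ⟩ = ℓ⁻³B`),
`⟨n̂₊⟩ = ∑ᵢ∫|QᵢΨ|²` and `⟨n̂₊²⟩ = ∑ᵢ∫|QᵢΨ|² + ∑_{i≠j}∫|QⱼQᵢΨ|²`, the sum of the `ŵ_{p0,q0}`-terms
`T = ℓ⁻³B - ρA` satisfies `T ≥ -[ρ - nℓ⁻³]₊ M ⟨n̂₊⟩ - ℓ⁻³ M ⟨n̂₊²⟩`.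
[cite: LiebSolovej2001, Lemma 5.3] -/
theorem ls_lemma53 (hℓ : 0 < ℓ) {Ψ : Config n → ℂ} (hΨ : Continuous Ψ) {m : Space → ℝ≥0∞}
    (hm : Measurable m) {Mr : ℝ} (hMr : 0 ≤ Mr) (hmle : ∀ x, m x ≤ ENNReal.ofReal Mr) (ρ : ℝ) :
    -(max (ρ - n / ℓ ^ 3) 0 * Mr *
          (∑ i : Fin n, ∫⁻ X in cellN n ℓ, (‖sliceFluct ℓ i Ψ X‖₊ : ℝ≥0∞) ^ 2).toReal) -
        (ℓ ^ 3)⁻¹ * Mr *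
          ((∑ i : Fin n, ∫⁻ X in cellN n ℓ, (‖sliceFluct ℓ i Ψ X‖₊ : ℝ≥0∞) ^ 2) +
            ∑ i : Fin n, ∑ j ∈ Finset.univ.erase i,
              ∫⁻ X in cellN n ℓ, (‖sliceFluct ℓ j (sliceFluct ℓ i Ψ) X‖₊ : ℝ≥0∞) ^ 2).toReal ≤
      (ℓ ^ 3)⁻¹ * (∑ i : Fin n, ∑ j ∈ Finset.univ.erase i,
          ∫⁻ X in cellN n ℓ, m (X i) * (‖sliceMean ℓ j (sliceFluct ℓ i Ψ) X‖₊ : ℝ≥0∞) ^ 2).toReal -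
        ρ * (∑ i : Fin n, ∫⁻ X in cellN n ℓ, m (X i) * (‖sliceFluct ℓ i Ψ X‖₊ : ℝ≥0∞) ^ 2).toReal := by
  have hMtop : ENNReal.ofReal Mr ≠ ⊤ := ENNReal.ofReal_ne_top
  -- the five sums and their finiteness
  set A : ℝ≥0∞ := ∑ i : Fin n, ∫⁻ X in cellN n ℓ, m (X i) * (‖sliceFluct ℓ i Ψ X‖₊ : ℝ≥0∞) ^ 2 with hA
  set B : ℝ≥0∞ := ∑ i : Fin n, ∑ j ∈ Finset.univ.erase i,
    ∫⁻ X in cellN n ℓ, m (X i) * (‖sliceMean ℓ j (sliceFluct ℓ i Ψ) X‖₊ : ℝ≥0∞) ^ 2 with hB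
  set D : ℝ≥0∞ := ∑ i : Fin n, ∑ j ∈ Finset.univ.erase i,
    ∫⁻ X in cellN n ℓ, m (X i) * (‖sliceFluct ℓ j (sliceFluct ℓ i Ψ) X‖₊ : ℝ≥0∞) ^ 2 with hD
  set NP : ℝ≥0∞ := ∑ i : Fin n, ∫⁻ X in cellN n ℓ, (‖sliceFluct ℓ i Ψ X‖₊ : ℝ≥0∞) ^ 2 with hNP
  set NQQ : ℝ≥0∞ := ∑ i : Fin n, ∑ j ∈ Finset.univ.erase i,
    ∫⁻ X in cellN n ℓ, (‖sliceFluct ℓ j (sliceFluct ℓ i Ψ) X‖₊ : ℝ≥0∞) ^ 2 with hNQQ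
  have hQc : ∀ i : Fin n, Continuous (sliceFluct ℓ i Ψ) := fun i => continuous_sliceFluct ℓ i hΨ
  have hPQc : ∀ i j : Fin n, Continuous (sliceMean ℓ j (sliceFluct ℓ i Ψ)) := fun i j =>
    continuous_sliceMean ℓ j (hQc i)
  have hQQc : ∀ i j : Fin n, Continuous (sliceFluct ℓ j (sliceFluct ℓ i Ψ)) := fun i j =>
    continuous_sliceFluct ℓ j (hQc i)
  have hAtop : A ≠ ⊤ := ENNReal.sum_ne_top.2 fun i _ =>
    (setLIntegral_cellN_weight_normSq_lt_top (hQc i) ℓ hMtop hmle i).ne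
  have hBtop : B ≠ ⊤ := ENNReal.sum_ne_top.2 fun i _ => ENNReal.sum_ne_top.2 fun j _ =>
    (setLIntegral_cellN_weight_normSq_lt_top (hPQc i j) ℓ hMtop hmle i).ne
  have hDtop : D ≠ ⊤ := ENNReal.sum_ne_top.2 fun i _ => ENNReal.sum_ne_top.2 fun j _ =>
    (setLIntegral_cellN_weight_normSq_lt_top (hQQc i j) ℓ hMtop hmle i).ne
  have hNPtop : NP ≠ ⊤ := ENNReal.sum_ne_top.2 fun i _ => (setLIntegral_cellN_normSq_lt_top (hQc i) ℓ).ne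
  have hNQQtop : NQQ ≠ ⊤ := ENNReal.sum_ne_top.2 fun i _ => ENNReal.sum_ne_top.2 fun j _ =>
    (setLIntegral_cellN_normSq_lt_top (hQQc i j) ℓ).ne
  -- `A ≤ M·NP`, `D ≤ M·NQQ`
  have hAle : A ≤ ENNReal.ofReal Mr * NP := by
    rw [hA, hNP, Finset.mul_sum]
    refine Finset.sum_le_sum fun i _ => ?_
    rw [← lintegral_const_mul' _ _ hMtop]
    exact lintegral_mono fun _ => mul_le_mul' (hmle _) le_rfl
  have hDle : D ≤ ENNReal.ofReal Mr * NQQ := by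
    rw [hD, hNQQ, Finset.mul_sum]
    refine Finset.sum_le_sum fun i _ => ?_
    rw [Finset.mul_sum]
    refine Finset.sum_le_sum fun j _ => ?_
    rw [← lintegral_const_mul' _ _ hMtop]
    exact lintegral_mono fun _ => mul_le_mul' (hmle _) le_rfl
  -- the identity
  have hid := sum_weight_identity hℓ hΨ hm
  rw [← hA, ← hB, ← hD] at hid
  -- pass to reals
  rcases Nat.eq_zero_or_pos n with hn | hn
  · subst hn
    have hA0 : A = 0 := by rw [hA]; simp
    have hB0 : B = 0 := by rw [hB]; simp
    have hNP0 : NP = 0 := by rw [hNP]; simp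
    have hNQQ0 : NQQ = 0 := by rw [hNQQ]; simp
    simp only [hA0, hB0, hNP0, hNQQ0, add_zero, ENNReal.toReal_zero, mul_zero, neg_zero, sub_zero]
    exact le_rfl
  have hn1 : ((n : ℝ≥0∞) - 1).toReal = (n : ℝ) - 1 := by
    rw [ENNReal.toReal_sub_of_le (by exact_mod_cast hn) (ENNReal.natCast_ne_top n)]
    simp
  have hidr : ((n : ℝ) - 1) * A.toReal = B.toReal + D.toReal := by
    have h := congrArg ENNReal.toReal hid
    rwa [ENNReal.toReal_mul, hn1, ENNReal.toReal_add hBtop hDtop] at h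
  have har : A.toReal ≤ Mr * NP.toReal := by
    have h := ENNReal.toReal_mono (ENNReal.mul_ne_top hMtop hNPtop) hAle
    rwa [ENNReal.toReal_mul, ENNReal.toReal_ofReal hMr] at h
  have hadr : A.toReal + D.toReal ≤ Mr * (NP + NQQ).toReal := by
    have h1 := ENNReal.toReal_mono (ENNReal.mul_ne_top hMtop hNQQtop) hDle
    rw [ENNReal.toReal_mul, ENNReal.toReal_ofReal hMr] at h1
    rw [ENNReal.toReal_add hNPtop hNQQtop]
    linarith
  exact lemma53_arith (pow_pos hℓ 3) hidr ENNReal.toReal_nonneg har hadr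

end Literature.MathematicalPhysics.QuantumManyBody.JelliumBoseGas
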